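import Summits.ABC.Analytic.RequirementsPeriod
import HarnessLib
import HarnessLib.Audit

/-!
# ABC — analytic / modular lens (IV-C): the PERIOD door with CONSTANT-CARRYING ranges (v1.2 repair, REF-A2 §F9)

Cell `abc-an` (C1), seat `typ-1` (KEY PR-PERIOD-FIX). Companion of `RequirementsPeriod` (file IV, rows R17(b)
`PolyModSymRat κ B` and R24 `TwistedCentralValueLowerBound B β`, the Goldfeld dictionary
`polyPeriodLowerBoundRat_of_polyModSymRat`). The referee (abc-an-ref-2, REF-A2 §F9, record f164933702f8c504, kernel
probes `chk/Probe_F9.lean` 396c8be64fc1f615) certified a JUNK EDGE of the landed typing: with the modulus range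
`q ≤ N^B` and NO constant in front of `N^B`, `TwistedCentralValueLowerBound B β` is FALSE for every
`B < log 5 / log 11 ≈ 0.671` (even sign: there is no even primitive Dirichlet character of prime conductor `< 5`;
witness conductor `N = 11`), independently of `β` — so the Lindelöf-range (`B = ½ + ε`) and «`B → 0`» shapes the
census rows (lens-6 R24, Hoffstein–Kontorovich 2010) speak of are not expressible by that decl. This file

* §1 puts that floor IN THE KERNEL (`not_twistedCentralValueLowerBound_of_rpow_lt_five`, `…_of_le_two_thirds`),
  modulo a modular parametrisation datum of a conductor-`11` curve — a CALIBRATION certificate, not evidence;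
* §2 types the REPAIRED rows `TwistedCentralValueLowerBoundC B β` (`∃ C_B ≥ 1`, modulus `0 < q ≤ C_B · N^B`) and
  `PolyModSymRatC κ B` (`∀ C_B ≥ 1`, all moduli `0 < q ≤ C_B · N^B`), with PRIME `q` DROPPED (REF-A2 N2: primality
  is not in print — Goldfeld 1990 uses real primitive `χ mod q`, `q ≪ N²`, composite allowed; Hoffstein–Kontorovich
  produce a fundamental discriminant; in the dictionary proof primality was bookkeeping only: Birch's bound
  `sqrt_mul_norm_twistedL_le_plus/minus` needs `q ≥ 1` and a PRIMITIVE character, nothing else);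
* §3 re-proves the dictionary for the C-pair with the SAME exponent `κ + β + B/2` (the constant moves from
  `c²/(652 C²)` to `c²/(652 C² C_B)`), its height corollary and the A-PS export BY NAME, and the one-line relations
  old ⇒ new: `TwistedCentralValueLowerBound B β → TwistedCentralValueLowerBoundC B β` (`C_B := 1`) and
  `PolyModSymRatC κ B → PolyModSymRat κ B` (`C_B := 1`, primes) — the C symbol row is the STRONGER hypothesis (every
  `C_B`, all moduli), the price of composing with an arbitrary twisted-row constant.

HONESTY: abc is not proved by any of this. The target of the export is **A-PS** = polynomial Szpiro over `ℚ`
(`Summit.ABC.PolySzpiroRat`), which is **NOT abc — «NOT abc — POLY-SZPIRO(E)»** (D-0139/D-0140); full abc / Szpiro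
`6+ε` (rung A0) is the main goal. Typed ≠ proved: the two `@[conjecture] def`s are OPEN statements used only as
hypotheses; every `theorem` is sorry-free; no new door — a repair of constants and a floor.

References: [Goldfeld1990ModularElliptic] §4 Conj. 4, (5)–(8); [Goldfeld1992ModularSymbols] (3);
[HoffsteinKontorovich2010] Thm. 4; [Birch1971]; [MazurTateTeitelbaum1986] §I.8; REF-A2 §F9 (abc-an-ref-2, 2026-08-27).
-/

noncomputable section

open scoped MatrixGroups ModularForm Classical

namespace Summit.ABC.Analytic

open Literature.NumberTheory.EllipticCurves Literature.NumberTheory.EllipticCurves.ModularForms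
open CongruenceSubgroup WeierstrassCurve

/-! ## §1 The small-`B` junk edge of `TwistedCentralValueLowerBound`, in the kernel (REF-A2 §F9 N1) -/

/-- There is no EVEN primitive Dirichlet character of prime conductor `< 5`: mod `2` no character is primitive
(`(ℤ/2)ˣ` is trivial), mod `3` the primitive character is odd. (REF-A2 §F9 probe P3.) [folklore] -/
theorem no_even_primitive_of_prime_lt_five {q : ℕ} (hq : q.Prime) (hq5 : q < 5)
    (χ : DirichletCharacter ℂ q) (hχ : χ.IsPrimitive) (heven : χ (-1) = 1) : False := by
  have h2 := hq.two_le
  interval_cases q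
  · have hu : ∀ u : (ZMod 2)ˣ, u = 1 := by decide
    have h1 : χ = 1 := MulChar.ext (fun u => by rw [hu u]; simp)
    have hc := (DirichletCharacter.eq_one_iff_conductor_eq_one).mp h1
    rw [DirichletCharacter.isPrimitive_def] at hχ
    omega
  · have hu : ∀ u : (ZMod 3)ˣ, u = 1 ∨ u = -1 := by decide
    have h1 : χ = 1 := MulChar.ext (fun u => by
      rcases hu u with rfl | rfl
      · simp
      · rw [MulChar.one_apply_coe, Units.val_neg, Units.val_one, heven])
    have hc := (DirichletCharacter.eq_one_iff_conductor_eq_one).mp h1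
    rw [DirichletCharacter.isPrimitive_def] at hχ
    omega
  · exact absurd hq (by norm_num)

/-- **N1 floor (REF-A2 §F9): `TwistedCentralValueLowerBound B β` is FALSE as typed whenever `11^B < 5`, i.e.
`B < log 5 / log 11 ≈ 0.6712`, independently of `β`**, modulo a modular parametrisation datum `Dt` of level `11`
of an elliptic `W/ℚ` of conductor `11` (e.g. `curve11A1`, `conductorNorm_curve11A1`; the datum is modularity, a
KNOWN fact kept as a hypothesis): the even-sign clause asks for an even primitive character of PRIME conductor
`q ≤ 11^B < 5`, and there is none (`no_even_primitive_of_prime_lt_five`). A CALIBRATION certificate of a junk edge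
(no constant in front of `N^B`), not evidence about twisted central values; the repaired row is
`TwistedCentralValueLowerBoundC`. [cite: HoffsteinKontorovich2010, Thm. 4 (the printed range carries `≪_ε`)] -/
theorem not_twistedCentralValueLowerBound_of_rpow_lt_five {B β : ℝ} (hB : (11 : ℝ) ^ B < 5)
    (W : WeierstrassCurve ℚ) [W.IsElliptic] (Dt : ModularParametrizationData W 11)
    (hN : W.conductorNorm ℤ = 11) : ¬ TwistedCentralValueLowerBound B β := by
  rintro ⟨c, _, h⟩
  obtain ⟨q, hq, hqle, χ, hχ, hχ1, -⟩ := h W 11 Dt hN 1 (Or.inl rfl)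
  have hq5 : q < 5 := by
    have : (q : ℝ) < 5 := hqle.trans_lt (by exact_mod_cast hB)
    exact_mod_cast this
  exact no_even_primitive_of_prime_lt_five hq hq5 χ hχ hχ1

/-- **N1 floor, rational instance**: for every `B ≤ 2/3` (in particular the Lindelöf range `B = ½ + ε`, `ε ≤ 1/6`)
and every `β`, `TwistedCentralValueLowerBound B β` is FALSE as typed, modulo a level-`11` datum of a conductor-`11`
curve (`11^(2/3) < 5` since `121 < 125`). [cite: HoffsteinKontorovich2010, Thm. 4] -/
theorem not_twistedCentralValueLowerBound_of_le_two_thirds {B β : ℝ} (hB : B ≤ 2 / 3)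
    (W : WeierstrassCurve ℚ) [W.IsElliptic] (Dt : ModularParametrizationData W 11)
    (hN : W.conductorNorm ℤ = 11) : ¬ TwistedCentralValueLowerBound B β := by
  refine not_twistedCentralValueLowerBound_of_rpow_lt_five ?_ W Dt hN
  have h1 : (11 : ℝ) ^ B ≤ (11 : ℝ) ^ (2 / 3 : ℝ) :=
    Real.rpow_le_rpow_of_exponent_le (by norm_num) hB
  have h2 : (11 : ℝ) ^ (2 / 3 : ℝ) < 5 := by
    rw [← Real.rpow_lt_rpow_iff (z := 3) (by positivity) (by norm_num) (by norm_num), ← Real.rpow_mul (by norm_num)]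
    norm_num
  exact h1.trans_lt h2

/-! ## §2 REPAIRED rows with a constant-carrying modulus range (REF-A2 §F9 fix line; OPEN, proof-free) -/

/-- **R24-C `TwistedCentralValueLowerBoundC B β`** — the constant-carrying form of `TwistedCentralValueLowerBound`:
for some `C_B ≥ 1` and `c > 0`, for every elliptic `W/ℚ` of conductor `N` with datum `Dt` and each sign `sgn = ±1`
there are a modulus `0 < q ≤ C_B · N^B` (NOT necessarily prime — REF-A2 N2: Goldfeld 1990 (7)–(8) uses real
primitive `χ mod q` with `q ≪ N²`, composite allowed; Hoffstein–Kontorovich 2010 Thm. 4 gives a FUNDAMENTAL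
DISCRIMINANT `d`, `|d| ≪_ε N^{1+ε}`, with `L(½, π ⊗ χ_d) ≠ 0`, under the hypothesis «root number of `L(s, π)` is
`≠ −1`» (REF-A2 N3; the sign of `d` is unspecified there) and with NO value bound) and a PRIMITIVE character
`χ mod q`, `χ(−1) = sgn`, whose twisted `L`-series continuation satisfies `|L(f ⊗ χ, 1)| ≥ c · N^{-β}`.
`TwistedCentralValueLowerBound B β` implies it (`C_B := 1`,
`twistedCentralValueLowerBoundC_of_twistedCentralValueLowerBound`); unlike that row it is NOT refuted at small `B`
by the conductor-`11` witness (`C_B ≥ 5` admits the even character mod `5`). CONTENT ONLY FOR `B > 0` (REF-A2 P1): at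
`B ≤ 0` it would assert a non-vanishing twist of BOUNDED conductor uniformly in `E`, which nothing in print claims.
STATUS: OPEN as typed for every `(B, β)`; in print only `(B, β) = (2, 0)` at sketch level (Goldfeld) and
non-vanishing without a value bound at `B = 1 + ε` (HK 2010). An INPUT, not a door; «NOT abc — POLY-SZPIRO(E)»
input (D-0139/D-0140). [cite: HoffsteinKontorovich2010, Thm. 4 (arXiv:1008.0839 p. 3)]
[cite: Goldfeld1990ModularElliptic, §4 (7)–(8)] -/
@[conjecture] def TwistedCentralValueLowerBoundC (B β : ℝ) : Prop :=
  ∃ C_B c : ℝ, 1 ≤ C_B ∧ 0 < c ∧ ∀ (W : WeierstrassCurve ℚ) [W.IsElliptic] (N : ℕ) [NeZero N]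
    (Dt : ModularParametrizationData W N), W.conductorNorm ℤ = N →
    ∀ sgn : ℂ, (sgn = 1 ∨ sgn = -1) →
      ∃ q : ℕ, 0 < q ∧ (q : ℝ) ≤ C_B * (N : ℝ) ^ B ∧
        ∃ χ : DirichletCharacter ℂ q, χ.IsPrimitive ∧ χ (-1) = sgn ∧
          ∃ L : ℂ → ℂ, Differentiable ℂ L ∧ (∀ s : ℂ, 2 < s.re → L s = twistedLSeries Dt.f χ s) ∧
            c * (N : ℝ) ^ (-β) ≤ ‖L 1‖

/-- **R17(b)-C `PolyModSymRatC κ B`** — the constant-carrying, all-moduli form of Goldfeld's modular-symbol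
conjecture (1990 Conj. 4 «`|m|, |n| ≪ N^κ` for `|c| ≤ N²`», all `c`, not only primes — REF-A2 N2): for EVERY
`C_B ≥ 1` there is `C` such that for every elliptic `W/ℚ` of conductor `N` with datum `Dt`, every modulus
`0 < q ≤ C_B · N^B` and every `a`, `|[a/q]^±_f| ≤ C · N^κ` (tree `normalizedPlusSymbol` / `normalizedMinusSymbol`).
The universal `C_B` is what lets the dictionary compose with ANY constant of the twisted row
(`polyPeriodLowerBoundRat_of_polyModSymRatC`); it implies the landed prime-only row `PolyModSymRat κ B`
(`polyModSymRat_of_polyModSymRatC`, `C_B := 1`) and is the STRONGER hypothesis. CONTENT ONLY FOR `B > 0` (REF-A2 P1: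
at `B ≤ 0` the range `q ≤ C_B` is a set of bounded denominators, `N`-free). OPEN; «NOT abc — POLY-SZPIRO(E)» input
(D-0139/D-0140). CALIBRATION: the floors quoted under `PolyModSymRat` (lens-6 j285435 `κ̂ = 0.79` at 1290h1;
ENG-MSYM) apply verbatim (they are computed at `q ≤ N^B`, inside every C-range); computed ≠ proved.
[cite: Goldfeld1990ModularElliptic, §4 Conj. 4] [cite: Goldfeld1992ModularSymbols, (3)] -/
@[conjecture] def PolyModSymRatC (κ B : ℝ) : Prop :=
  ∀ C_B : ℝ, 1 ≤ C_B → ∃ C : ℝ, ∀ (W : WeierstrassCurve ℚ) [W.IsElliptic] (N : ℕ) [NeZero N]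
    (Dt : ModularParametrizationData W N), W.conductorNorm ℤ = N →
    ∀ q : ℕ, 0 < q → (q : ℝ) ≤ C_B * (N : ℝ) ^ B → ∀ a : ℤ,
      |normalizedPlusSymbol Dt.f ((a : ℚ) / q)| ≤ C * (N : ℝ) ^ κ ∧
      |normalizedMinusSymbol Dt.f ((a : ℚ) / q)| ≤ C * (N : ℝ) ^ κ

/-- **old ⇒ C (twisted row)**: the landed prime/constant-free row is the `C_B = 1` special case.
[cite: Goldfeld1990ModularElliptic, §4 (8)] -/
theorem twistedCentralValueLowerBoundC_of_twistedCentralValueLowerBound {B β : ℝ}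
    (h : TwistedCentralValueLowerBound B β) : TwistedCentralValueLowerBoundC B β := by
  obtain ⟨c, hc, h⟩ := h
  refine ⟨1, c, le_rfl, hc, fun W _ N _ Dt hN sgn hsgn => ?_⟩
  obtain ⟨q, hq, hqle, χ, hχ, hχ1, L, hL, hL', hval⟩ := h W N Dt hN sgn hsgn
  exact ⟨q, hq.pos, by rwa [one_mul], χ, hχ, hχ1, L, hL, hL', hval⟩

/-- **C ⇒ old (symbol row)**: `PolyModSymRatC κ B → PolyModSymRat κ B` (`C_B := 1`, restrict to prime moduli).
[cite: Goldfeld1990ModularElliptic, §4 Conj. 4] -/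
theorem polyModSymRat_of_polyModSymRatC {κ B : ℝ} (h : PolyModSymRatC κ B) : PolyModSymRat κ B := by
  obtain ⟨C, hC⟩ := h 1 le_rfl
  exact ⟨C, fun W _ N _ Dt hN q hq hqle a => hC W N Dt hN q hq.pos (by rwa [one_mul]) a⟩

/-! ## §3 The Goldfeld dictionary for the C-pair (PROVED implication; same exponent `κ + β + B/2`) -/

section Dictionary

/-- **THE GOLDFELD DICTIONARY THEOREM, constant-carrying form (REF-A2 §F9 fix line).** Modulo the KNOWN named facts
modularity (`hmod`) and Mazur–Kenku (`h163`):
`PolyModSymRatC κ B → TwistedCentralValueLowerBoundC B β → PolyPeriodLowerBoundRat (κ + β + B/2)`.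
Same chain as `polyPeriodLowerBoundRat_of_polyModSymRat` with `Q := C_B · N^B` in `le_sqrt_mul_of_sqrt_mul_le`:
per parity Birch + the symbol bound give `c N^{-β} ≤ √(C_B N^B) · C N^κ · Ω^±_f`; the period sandwich
`Ω⁺_f Ω⁻_f ≤ 652 covol(Λ_W)` (`periods_le_mul_covolume`) gives `covol ≥ c²/(652 C² C_B) · N^{-2(κ+β+B/2)}`.
NO primality and NO Manin-constant hypothesis. «NOT abc — POLY-SZPIRO(12κ + 12β + 6B)» once exported; abc is NOT
proved. [cite: Goldfeld1990ModularElliptic, §4 Conj. 4 and (5)–(8)] [cite: Birch1971] [cite: ZagierCMB1985, §1] -/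
theorem polyPeriodLowerBoundRat_of_polyModSymRatC {κ B β : ℝ} (hmod : nonempty_modularParametrizationData)
    (h163 : PastenShimura2024_minimalDegree_le_163_mul)
    (hsym : PolyModSymRatC κ B) (htw : TwistedCentralValueLowerBoundC B β) :
    PolyPeriodLowerBoundRat (κ + β + B / 2) := by
  obtain ⟨C_B, c, hCB, hc, htw⟩ := htw
  obtain ⟨C₀, hC₀⟩ := hsym C_B hCB
  have hCBpos : 0 < C_B := lt_of_lt_of_le one_pos hCB
  -- a positive symbol constant
  set C := max C₀ 1 with hCdef
  have hC1 : 1 ≤ C := le_max_right _ _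
  have hCpos : 0 < C := lt_of_lt_of_le one_pos hC1
  refine ⟨-Real.log (c ^ 2 / (652 * C ^ 2 * C_B)), fun W _ _ => ?_⟩
  haveI : NeZero (W.conductorNorm ℤ) := NeZero.of_pos (conductorNorm_pos_holds W)
  have hNpos : (0 : ℝ) < ((W.conductorNorm ℤ : ℕ) : ℝ) := by exact_mod_cast conductorNorm_pos_holds W
  set x : ℝ := ((W.conductorNorm ℤ : ℕ) : ℝ) with hxdef
  obtain ⟨D⟩ := hmod W
  have hplus : 0 < plusPeriod D.f := D.plusPeriod_newform_pos
  have hminus : 0 < minusPeriod D.f :=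
    IsNewform0.minusPeriod_pos_holds D.isNewformOf.1 D.isNewformOf.coeffField_eq_bot
  have hsymD := hC₀ W (W.conductorNorm ℤ) D rfl
  have hxκ : 0 ≤ x ^ κ := Real.rpow_nonneg hNpos.le κ
  have hQ : 0 ≤ C_B * x ^ B := mul_nonneg hCBpos.le (Real.rpow_nonneg hNpos.le B)
  -- EVEN character: `c x^{-β} ≤ √(C_B x^B) · C x^κ · Ω⁺_f`
  obtain ⟨q, hq, hqle, χ, hχ, hχ1, L, hL, hL', hval⟩ := htw W (W.conductorNorm ℤ) D rfl 1 (Or.inl rfl)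
  haveI : NeZero q := ⟨hq.ne'⟩
  have hqpos : (0 : ℝ) < q := by exact_mod_cast hq
  have hMp : ∀ a : ℤ, |normalizedPlusSymbol D.f ((a : ℚ) / q)| ≤ C * x ^ κ := fun a =>
    ((hsymD q hq hqle a).1).trans (mul_le_mul_of_nonneg_right (le_max_left _ _) hxκ)
  have hP : c * x ^ (-β) ≤ Real.sqrt (C_B * x ^ B) * (C * x ^ κ) * plusPeriod D.f :=
    hval.trans (le_sqrt_mul_of_sqrt_mul_le hqpos hqle (by positivity) hplus.le
      (sqrt_mul_norm_twistedL_le_plus D hχ hχ1 hL hL' hMp))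
  -- ODD character: `c x^{-β} ≤ √(C_B x^B) · C x^κ · Ω⁻_f`
  obtain ⟨q', hq', hqle', χ', hχ', hχ1', L', hL₁, hL₁', hval'⟩ :=
    htw W (W.conductorNorm ℤ) D rfl (-1) (Or.inr rfl)
  haveI : NeZero q' := ⟨hq'.ne'⟩
  have hqpos' : (0 : ℝ) < q' := by exact_mod_cast hq'
  have hMm : ∀ a : ℤ, |normalizedMinusSymbol D.f ((a : ℚ) / q')| ≤ C * x ^ κ := fun a =>
    ((hsymD q' hq' hqle' a).2).trans (mul_le_mul_of_nonneg_right (le_max_left _ _) hxκ)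
  have hM : c * x ^ (-β) ≤ Real.sqrt (C_B * x ^ B) * (C * x ^ κ) * minusPeriod D.f :=
    hval'.trans (le_sqrt_mul_of_sqrt_mul_le hqpos' hqle' (by positivity) hminus.le
      (sqrt_mul_norm_twistedL_le_minus D hχ' hχ1' hL₁ hL₁' hMm))
  -- the sandwich and the covolume of the (Néron) lattice of `D`
  have hsand : plusPeriod D.f * minusPeriod D.f ≤ 652 * ZLattice.covolume D.L.lattice :=
    periods_le_mul_covolume hmod h163 W D
  have hcov_eq : (W.baseChange ℂ).complexPeriod / 2 = ZLattice.covolume D.L.lattice := by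
    have h2 := D.two_mul_covolume_eq_complexPeriod
    linarith
  have hcov : 0 < ZLattice.covolume D.L.lattice := ZLattice.covolume_pos _ _
  rw [hcov_eq, neg_neg, Real.exp_log (by positivity)]
  -- bookkeeping of the exponents
  have hsq : Real.sqrt (C_B * x ^ B) * Real.sqrt (C_B * x ^ B) = C_B * x ^ B := Real.mul_self_sqrt hQ
  have hcβ : 0 ≤ c * x ^ (-β) := by positivity
  have hprod : (c * x ^ (-β)) * (c * x ^ (-β)) ≤
      (Real.sqrt (C_B * x ^ B) * (C * x ^ κ) * plusPeriod D.f) *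
        (Real.sqrt (C_B * x ^ B) * (C * x ^ κ) * minusPeriod D.f) :=
    mul_le_mul hP hM hcβ (hcβ.trans hP)
  have k1 : c ^ 2 * (x ^ (-β) * x ^ (-β)) = (c * x ^ (-β)) * (c * x ^ (-β)) := by ring
  have k2 : (Real.sqrt (C_B * x ^ B) * (C * x ^ κ) * plusPeriod D.f) *
      (Real.sqrt (C_B * x ^ B) * (C * x ^ κ) * minusPeriod D.f) =
      (Real.sqrt (C_B * x ^ B) * Real.sqrt (C_B * x ^ B)) * C ^ 2 * (x ^ κ * x ^ κ) *
        (plusPeriod D.f * minusPeriod D.f) := by ring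
  rw [hsq] at k2
  have k3 : C_B * x ^ B * C ^ 2 * (x ^ κ * x ^ κ) * (plusPeriod D.f * minusPeriod D.f) ≤
      C_B * x ^ B * C ^ 2 * (x ^ κ * x ^ κ) * (652 * ZLattice.covolume D.L.lattice) :=
    mul_le_mul_of_nonneg_left hsand (by positivity)
  have k4 : C_B * x ^ B * C ^ 2 * (x ^ κ * x ^ κ) * (652 * ZLattice.covolume D.L.lattice) =
      ZLattice.covolume D.L.lattice * (652 * C ^ 2 * C_B * (x ^ B * x ^ κ * x ^ κ)) := by ring
  have key : c ^ 2 * (x ^ (-β) * x ^ (-β)) ≤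
      ZLattice.covolume D.L.lattice * (652 * C ^ 2 * C_B * (x ^ B * x ^ κ * x ^ κ)) :=
    (k1.trans_le (hprod.trans (k2.le.trans k3))).trans_eq k4
  have hx : x ^ (-(2 * (κ + β + B / 2))) = x ^ (-β) * x ^ (-β) / (x ^ B * x ^ κ * x ^ κ) := by
    rw [show -(2 * (κ + β + B / 2)) = (-β + -β) - (B + κ + κ) by ring, Real.rpow_sub hNpos,
      Real.rpow_add hNpos, Real.rpow_add hNpos, Real.rpow_add hNpos]
  have k5 : c ^ 2 / (652 * C ^ 2 * C_B) * (x ^ (-β) * x ^ (-β) / (x ^ B * x ^ κ * x ^ κ)) =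
      c ^ 2 * (x ^ (-β) * x ^ (-β)) / (652 * C ^ 2 * C_B * (x ^ B * x ^ κ * x ^ κ)) :=
    div_mul_div_comm _ _ _ _
  rw [hx, k5, div_le_iff₀ (by positivity)]
  exact key

/-- **Compatibility**: the C-dictionary with the LANDED twisted row (old ⇒ C on the twisted side):
`PolyModSymRatC κ B → TwistedCentralValueLowerBound B β → PolyPeriodLowerBoundRat (κ + β + B/2)`.
[cite: Goldfeld1990ModularElliptic, §4 Conj. 4 ⇒ Conj. 1] -/
theorem polyPeriodLowerBoundRat_of_polyModSymRatC_of_twistedCentralValueLowerBound {κ B β : ℝ}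
    (hmod : nonempty_modularParametrizationData) (h163 : PastenShimura2024_minimalDegree_le_163_mul)
    (hsym : PolyModSymRatC κ B) (htw : TwistedCentralValueLowerBound B β) :
    PolyPeriodLowerBoundRat (κ + β + B / 2) :=
  polyPeriodLowerBoundRat_of_polyModSymRatC hmod h163 hsym
    (twistedCentralValueLowerBoundC_of_twistedCentralValueLowerBound htw)

/-- **Corollary BY NAME (height row)**: `PolyModSymRatC κ B → TwistedCentralValueLowerBoundC B β →
PolyFaltingsHeightRat (κ + β + B/2)`, modulo modularity and Mazur–Kenku. «NOT abc — POLY-SZPIRO(12κ + 12β + 6B)»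
(D-0139/D-0140). [cite: Goldfeld1990ModularElliptic, §4 Conj. 4 ⇒ Conj. 1] -/
theorem polyFaltingsHeightRat_of_polyModSymRatC {κ B β : ℝ} (hmod : nonempty_modularParametrizationData)
    (h163 : PastenShimura2024_minimalDegree_le_163_mul)
    (hsym : PolyModSymRatC κ B) (htw : TwistedCentralValueLowerBoundC B β) :
    PolyFaltingsHeightRat (κ + β + B / 2) :=
  (polyPeriodLowerBoundRat_iff_polyFaltingsHeightRat _).1
    (polyPeriodLowerBoundRat_of_polyModSymRatC hmod h163 hsym htw)

/-- **A-PS export BY NAME, constant-carrying form**: `PolyModSymRatC κ B → TwistedCentralValueLowerBoundC B β →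
Summit.ABC.PolySzpiroRat`, modulo modularity (`hmod`) and Mazur–Kenku (`h163`). abc is NOT proved; A-PS is
«NOT abc — POLY-SZPIRO(12κ + 12β + 6B)». [cite: Goldfeld1990ModularElliptic, §4 "Assuming the Taniyama–Weil conjecture, Conjecture 4 is equivalent to Szpiro's Conjecture 1"] -/
theorem polySzpiroRat_of_polyModSymRatC {κ B β : ℝ} (hmod : nonempty_modularParametrizationData)
    (h163 : PastenShimura2024_minimalDegree_le_163_mul)
    (hsym : PolyModSymRatC κ B) (htw : TwistedCentralValueLowerBoundC B β) : Summit.ABC.PolySzpiroRat :=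
  polySzpiroRat_of_polyPeriodLowerBoundRat (polyPeriodLowerBoundRat_of_polyModSymRatC hmod h163 hsym htw)

end Dictionary

end Summit.ABC.Analytic

end
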